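import Literature.MathematicalPhysics.QuantumFieldTheory.Balaban1983to89.B11Eq117LetterDefects
import Literature.MathematicalPhysics.QuantumFieldTheory.Balaban1983to89.B9Eq3153FrakGLipschitzTwoBackgrounds

/-!
# `Balaban1983to89.B11Eq117LetterDefectsTwoBackgrounds` — T. Bałaban, *The variational problem and background fields in renormalization group method
# for lattice gauge theories*, Commun. Math. Phys. **102** (1985) 277–309 [Balaban1985Variational] (115)∕(117) pp. 294–295 with [Balaban1985BackgroundPropagators]
# Thm 3.4 p. 400, (3.126) p. 420, (3.153) p. 426: THE CHART'S LETTERS `𝔊(U)`, `H₁(U)` READ ACROSS THE (115) NORMS OF TWO SMALL-BOND BACKGROUNDS — the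
# identity of configurations `Space115 … (∇_U) → Space115 … (∇_{U′})` is bounded by `1 + w̄₁·2|η|⁻¹δ·w̲₀⁻¹` (`‖U(b) − U′(b)‖ ≤ δ`), and through it
# `‖𝔊(U)f − 𝔊(U′)f‖_(115),∇_{U′} ≤ K_G·δ·|f|_(−3)`, `‖H₁(U)B − H₁(U′)B‖_(115),∇_{U′} ≤ K_A·δ·|B|_(−0)` at every pair of small-bond backgrounds of a
# fixed lattice — the intertwining defects `δ_G`, `δ_A`, `K_ι` of `B11Eq120SolutionContinuity` BETWEEN TWO GENERAL `U`, `U′`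

statement-level skeleton of published theorems with citation tags; proofs where landed; nothing here is a claim about the Yang–Mills mass gap

PDF held: `paper:balaban1985-cmp102-variational` ∕ `paper:balaban1985-cmp99-background-propagators`; (115)∕(117), Thm 3.4, (3.126), (3.153) through the
verbatim quotations of `B11Eq117LetterDefects` (NE9 owner gen 82), whose §4 this file runs a second time between two backgrounds.

CITATION HEADER (lean-in-tree rule 2026-08-18).  Audit cell `pub-balaban`, sub-cell `t4`, NE9 crux team (2): LEAF PROVER 04
(`b2b-balaban-t4-ne9-formalise-leaf-04` gen 73) — the TWO-BACKGROUND twin of the NE9 owner's (B′) `B11Eq117LetterDefects.exists_letter_defects_at_flat`,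
the fifth junction above this lineage's two-background letters for the owner's census item (i) «two general small fields» (journal `CLAIMS.log`
l.42142); inputs (Q2)₂ `B9Eq386LipschitzH1TwoBackgrounds`, (Q3)₂ `B9Eq3153FrakGLipschitzTwoBackgrounds`, and the owner's §1∕§3 transfer lemmas
`norm_jetId_le`, `norm_toCLM115_readFun_sub_le`, `norm_H1CLM_sub_le`, `jetId_frakG_eq_toCLM115_readFun`, `frakG_eq_toCLM115_readFun` BY NAME.

WHAT IS PROVED (sorry-free; no `Prop` placeholder; no inequality of the paper asserted).
* §1 **`norm_nabla115_sub_le`** — `‖∇_U A − ∇_{U′} A‖_∞ ≤ 2|η|⁻¹·δ·‖A‖_∞` for two `U1`-valued backgrounds with `‖U(b) − U′(b)‖ ≤ δ`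
  (`B9Eq319QprimeLipschitzTwoBackgrounds.norm_conj_sub_conj_le_of_mem_U1`); `norm_jetId_nabla_twoBackgrounds_le` — `‖ι_{∇_U→∇_{U′}} f‖ ≤
  (1 + w̄₁·2|η|⁻¹δ·w̲₀⁻¹)·‖f‖`.
* §2 **`exists_letter_defects_twoBackgrounds`** — `∃ K_G K_A ε₉ > 0 ∀ U U′` (their `QtorusW` letters, `‖U(b) − 1‖, ‖U′(b) − 1‖ ≤ ε ≤ ε₉`,
  `‖U(b) − U′(b)‖ ≤ δ`, `hRS`, `hRS′`) `∀ hpos hQ` (at `U`) `∀ hpos′ hQ′` (at `U′`): `‖ι(𝔊(U)f) − 𝔊(U′)f‖ ≤ K_G·δ·‖f‖` and `‖ι(H₁(U)B) − H₁(U′)B‖ ≤ K_A·δ·‖B‖`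
  in the (115) norm at `∇_{U′}` — (Q3)₂ ∕ (Q2)₂ read through `B11Eq117TransformationNorm` (the owner's §3) and `ι ∘ toCLM115(∇_U) = toCLM115(∇_{U′})` (§1).
MODEL / HONEST SCOPE.  As `B11Eq117LetterDefects`: finite index sets, finite-dimensional fibre, every constant a finite-lattice number; both backgrounds in
the small-bond ball; NOT print's lattice-uniform statement, NOT analyticity in `A`; the chart between two general small fields ((B″)₂ ∕ (Z)₂) is NOT
here — its displayed defects `δ_G`, `δ_A`, `K_ι` are; NOT summit progress (cell pub-balaban: NE9 NOT PRINTED ∕ NOT PROVED; spine PROVED 0∕9; rung (B)+1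
finite T⁴ — NOT infinite volume, NOT mass gap, NOT BetaPertH, NOT Clay).  NEW file importing `B11Eq117LetterDefects`, `B9Eq3153FrakGLipschitzTwoBackgrounds`;
nothing of the NE9-owner lineage's files is modified.  Net new unproved facts: 0.
-/

noncomputable section

namespace Literature.MathematicalPhysics.QuantumFieldTheory.Balaban1983to89.B11Eq117LetterDefectsTwoBackgrounds

open scoped InnerProductSpace
open Metric Set
open B11Eq115Space B11Eq111FrakG B11Eq103H1Complex
open B11Eq117TransformationNorm (norm_nabla115_le)
open B11Eq117LetterDefects (norm_jetId_le norm_toCLM115_readFun_sub_le norm_H1CLM_sub_le jetId_frakG_eq_toCLM115_readFun frakG_eq_toCLM115_readFun)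
open B9Eq311L2Pairing (WL2)
open B9SectCLatticeCarrier (Bond)
open B4Sect5Torus (TSite)
open B7Prop1Explicit (U1 Wcx boxVec)
open B9Eq319QprimeTorus (fineP)
open B9Eq310HessianOperator (adTransportW hessOp)
open B9Eq315QTorus (perCfg cornerSite QtorusW laplaceAofBackground)
open B9Eq315QTorusOnto (liftSite perSite_liftSite)
open B9Eq386LipschitzH1TwoBackgrounds (exists_lipschitz_G1_H1_twoBackgrounds)
open B9Eq3153FrakGLipschitzTwoBackgrounds (exists_lipschitz_frakG_twoBackgrounds)
open B9Eq319QprimeLipschitzTwoBackgrounds (norm_conj_sub_conj_le_of_mem_U1)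

/-! ## §1 The derivative letters of (115) at two backgrounds: `‖∇_U A − ∇_{U′} A‖_∞ ≤ 2|η|⁻¹·δ·‖A‖_∞` -/

section Nabla

variable {d : ℕ} {Pd : Fin d → ℕ} {𝔸 : Type*} [NormedRing 𝔸] [NormedAlgebra ℂ 𝔸] [NormOneClass 𝔸]

/-- **`‖∇_U A − ∇_{U′} A‖_∞ ≤ 2|η|⁻¹·δ·‖A‖_∞`** for two unit-bounded backgrounds `δ`-close bondwise: pointwise `(∇_U A − ∇_{U′} A)(b, ν) =
η⁻¹(U A(b₊) U⁻¹ − U′ A(b₊) U′⁻¹)`, two conjugations `2δ`-apart ([B9] (3.3)). [cite: Balaban1985BackgroundPropagators, (3.3) p.391; Balaban1985Variational, (115) p.294] -/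
theorem norm_nabla115_sub_le (η : ℝ) (U U' : Bond d Pd → 𝔸ˣ) (hU1 : ∀ b, U b ∈ U1 𝔸) (hU1' : ∀ b, U' b ∈ U1 𝔸) {δ : ℝ} (hδ : 0 ≤ δ)
    (hUU' : ∀ b, ‖(U b : 𝔸) - (U' b : 𝔸)‖ ≤ δ) (A : Bond d Pd → 𝔸) :
    ‖nabla115 η U' A - nabla115 η U A‖ ≤ 2 * ‖((η : ℂ))⁻¹‖ * δ * ‖A‖ := by
  refine (pi_norm_le_iff_of_nonneg (by positivity)).2 fun bν => ?_
  obtain ⟨b, ν⟩ := bν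
  rw [Pi.sub_apply, nabla115_apply, nabla115_apply, ← smul_sub, sub_sub_sub_cancel_right, norm_smul]
  have h1 : ‖(U' b : 𝔸) * A (B9SectCLatticeCarrier.btgt b, ν) * (((U' b)⁻¹ : 𝔸ˣ) : 𝔸) -
      (U b : 𝔸) * A (B9SectCLatticeCarrier.btgt b, ν) * (((U b)⁻¹ : 𝔸ˣ) : 𝔸)‖ ≤ 2 * δ * ‖A (B9SectCLatticeCarrier.btgt b, ν)‖ := by
    refine (norm_conj_sub_conj_le_of_mem_U1 (hU1' b) (hU1 b) _).trans ?_
    refine mul_le_mul_of_nonneg_right (mul_le_mul_of_nonneg_left ?_ (by norm_num)) (norm_nonneg _)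
    rw [norm_sub_rev]; exact hUU' b
  have h2 : ‖A (B9SectCLatticeCarrier.btgt b, ν)‖ ≤ ‖A‖ := norm_le_pi_norm A _
  calc ‖((η : ℂ))⁻¹‖ * ‖(U' b : 𝔸) * A (B9SectCLatticeCarrier.btgt b, ν) * (((U' b)⁻¹ : 𝔸ˣ) : 𝔸) -
        (U b : 𝔸) * A (B9SectCLatticeCarrier.btgt b, ν) * (((U b)⁻¹ : 𝔸ˣ) : 𝔸)‖
      ≤ ‖((η : ℂ))⁻¹‖ * (2 * δ * ‖A‖) :=
        mul_le_mul_of_nonneg_left (h1.trans (mul_le_mul_of_nonneg_left h2 (by positivity))) (norm_nonneg _)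
    _ = 2 * ‖((η : ℂ))⁻¹‖ * δ * ‖A‖ := by ring

end Nabla

/-! ## §2 At the chain's letters: the defects `K_ι`, `δ_G`, `δ_A` between two small-bond backgrounds of a fixed lattice -/

section Letters

variable {d : ℕ} (L : ℕ) [NeZero L] (m : Fin d → ℕ) [∀ i, NeZero (fineP L m i)] (hL : 1 ≤ L)
  {𝔸 : Type*} [NormedRing 𝔸] [NormedAlgebra ℂ 𝔸] [CompleteSpace 𝔸] [NormOneClass 𝔸] [StarRing 𝔸] [NormedStarGroup 𝔸] [StarModule ℂ 𝔸]
  [FiniteDimensional ℂ 𝔸]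
  {W : Type*} [NormedAddCommGroup W] [InnerProductSpace ℂ W] [FiniteDimensional ℂ W] (φ : W ≃ₗ[ℂ] 𝔸) {c₀ c₁ : ℝ} [Fact (0 < c₀)] [Fact (0 < c₁)]

omit [NeZero L] [∀ i, NeZero (fineP L m i)] [CompleteSpace 𝔸] [StarRing 𝔸] [NormedStarGroup 𝔸] [StarModule ℂ 𝔸] in
/-- **`‖ι_{∇_U→∇_{U′}} f‖ ≤ (1 + w̄₁·2|η|⁻¹δ·w̲₀⁻¹)·‖f‖`** — the jet identity from the (115) norm at `U` to the (115) norm at `U′`, for two unit-bounded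
backgrounds `δ`-close bondwise (the owner's `norm_jetId_le` + §1). [cite: Balaban1985Variational, (115) p.294; Balaban1985BackgroundPropagators, (3.3) p.391] -/
theorem norm_jetId_nabla_twoBackgrounds_le {η : ℝ} [Fact (0 < (L : ℝ))] [Fact (0 < η)] {lev₀ : Bond d (fineP L m) → ℕ}
    (lev₁ : Bond d (fineP L m) × Fin d → ℕ) (U U' : Bond d (fineP L m) → 𝔸ˣ) (hU1 : ∀ b, U b ∈ U1 𝔸) (hU1' : ∀ b, U' b ∈ U1 𝔸)
    {δ : ℝ} (hδ : 0 ≤ δ) (hUU' : ∀ b, ‖(U b : 𝔸) - (U' b : 𝔸)‖ ≤ δ) (f : Space115 (L : ℝ) η lev₀ lev₁ (nabla115 η U)) :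
    ‖LinearMap.toContinuousLinearMap
        ((jetLinearEquiv (L : ℝ) η lev₀ lev₁ (nabla115 η U')).symm.toLinearMap ∘ₗ
          (jetLinearEquiv (L : ℝ) η lev₀ lev₁ (nabla115 η U)).toLinearMap) f‖ ≤
      (1 + (NegSup.wSup (levWeight (L : ℝ) η lev₁ 2) : ℝ) * (2 * ‖((η : ℂ))⁻¹‖ * δ) * NegSup.wInvSup (levWeight (L : ℝ) η lev₀ 1)) * ‖f‖ :=
  norm_jetId_le lev₁ (nabla115 η U) (nabla115 η U') (by positivity) (norm_nabla115_sub_le η U U' hU1 hU1' hδ hUU') f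

set_option maxHeartbeats 800000 in
set_option maxRecDepth 8192 in
/-- **THE LETTER DEFECTS BETWEEN TWO SMALL-BOND BACKGROUNDS, AT A FIXED LATTICE** — for the chain's `𝔊(V) = frakGLatticeCLM …(∇_V)` and `H₁(V) = H1LatticeCLM
…(∇_V)` read in the (115) norm at `∇_{U′}` through the jet identity `ι = ι_{∇_U→∇_{U′}}`: there are `K_G, K_A, ε₉ > 0` (finite-lattice numbers, for FIXED level
maps) such that for EVERY pair `U`, `U′` of E162's data with `‖U(b) − 1‖, ‖U′(b) − 1‖ ≤ ε ≤ ε₉`, `‖U(b) − U′(b)‖ ≤ δ`, `hRS`, `hRS′`, and ANY `hpos, hQ` at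
`U`, `hpos′, hQ′` at `U′`: `‖ι(𝔊(U)f) − 𝔊(U′)f‖ ≤ K_G·δ·‖f‖` and `‖ι(H₁(U)B) − H₁(U′)B‖ ≤ K_A·δ·‖B‖` — the owner's §4 with `U′` for `1`, fed by (Q3)₂ ∕ (Q2)₂.
[cite: Balaban1985BackgroundPropagators, Thm 3.4 p.400, (3.86) p.407, (3.126) p.420, (3.153) p.426; Balaban1985Variational, (103) p.293, (111) p.294, (117) p.295] -/
theorem exists_letter_defects_twoBackgrounds {η : ℝ} [Fact (0 < (L : ℝ))] [Fact (0 < η)] (lev₀ : Bond d (fineP L m) → ℕ) (levB : Bond d m → ℕ)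
    (lev₁ : Bond d (fineP L m) × Fin d → ℕ) {a : ℝ} (ha : 0 < a) {Mφ Mφ' : ℝ} (hMφ : 0 ≤ Mφ) (hMφ' : 0 ≤ Mφ')
    (hφ : ∀ w, ‖φ w‖ ≤ Mφ * ‖w‖) (hφ' : ∀ X, ‖φ.symm X‖ ≤ Mφ' * ‖X‖) (τ : 𝔸 →ₗ[ℂ] ℂ) {Cτ : ℝ} (hτ : ∀ X, ‖τ X‖ ≤ Cτ * ‖X‖) (hCτ : 0 ≤ Cτ) :
    ∃ KG KA ε₉ : ℝ, 0 < KG ∧ 0 < KA ∧ 0 < ε₉ ∧ ∀ (U U' : Bond d (fineP L m) → 𝔸ˣ) {α α' : ℝ} (hα1 : α ≤ 1 / 64)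
      (hU1 : ∀ (x : B7Prop1Explicit.Site d) (κ : Fin d), perCfg (fineP L m) U x κ ∈ U1 𝔸)
      (hreg : ∀ (y : TSite d m) (κ : Fin d) (r : Fin d → Fin L), ‖((Wcx L (perCfg (fineP L m) U) (cornerSite L y) κ (boxVec L r) : 𝔸ˣ) : 𝔸) - 1‖ ≤ α)
      (hα1' : α' ≤ 1 / 64)
      (hU1' : ∀ (x : B7Prop1Explicit.Site d) (κ : Fin d), perCfg (fineP L m) U' x κ ∈ U1 𝔸)
      (hreg' : ∀ (y : TSite d m) (κ : Fin d) (r : Fin d → Fin L), ‖((Wcx L (perCfg (fineP L m) U') (cornerSite L y) κ (boxVec L r) : 𝔸ˣ) : 𝔸) - 1‖ ≤ α')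
      {ε δ : ℝ}, 0 ≤ ε → ε ≤ ε₉ → 0 ≤ δ → (∀ b, ‖(U b : 𝔸) - 1‖ ≤ ε) → (∀ b, ‖(U' b : 𝔸) - 1‖ ≤ ε) →
      (∀ b, ‖(U b : 𝔸) - (U' b : 𝔸)‖ ≤ δ) →
      (∀ (b : Bond d (fineP L m)) (v u : W), ⟪adTransportW φ U b v, u⟫_ℂ = ⟪v, adTransportW φ (fun b => (U b)⁻¹) b u⟫_ℂ) →
      (∀ (b : Bond d (fineP L m)) (v u : W), ⟪adTransportW φ U' b v, u⟫_ℂ = ⟪v, adTransportW φ (fun b => (U' b)⁻¹) b u⟫_ℂ) →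
      ∀ (hpos : ∀ x : BondL2K ℂ d (fineP L m) c₀ W, x ≠ 0 →
          0 < RCLike.re ⟪x, laplaceAofBackground L m hL φ U hα1 hU1 hreg τ η (c₀ := c₀) (c₁ := c₁) a x⟫_ℂ)
        (hQ : Function.Surjective (QtorusW L m hL φ U hα1 hU1 hreg (c₀ := c₀) (c₁ := c₁)))
        (hpos' : ∀ x : BondL2K ℂ d (fineP L m) c₀ W, x ≠ 0 →
          0 < RCLike.re ⟪x, laplaceAofBackground L m hL φ U' hα1' hU1' hreg' τ η (c₀ := c₀) (c₁ := c₁) a x⟫_ℂ)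
        (hQ' : Function.Surjective (QtorusW L m hL φ U' hα1' hU1' hreg' (c₀ := c₀) (c₁ := c₁))),
      (∀ f : NegSize (L : ℝ) η lev₀ 3 𝔸,
        ‖LinearMap.toContinuousLinearMap
            ((jetLinearEquiv (L : ℝ) η lev₀ lev₁ (nabla115 η U')).symm.toLinearMap ∘ₗ
              (jetLinearEquiv (L : ℝ) η lev₀ lev₁ (nabla115 η U)).toLinearMap)
            (frakGLatticeCLM (L := (L : ℝ)) (η := η) (lev₀ := lev₀) φ hpos hQ lev₁ (nabla115 η U) f) -
          frakGLatticeCLM (L := (L : ℝ)) (η := η) (lev₀ := lev₀) (Δ₁ := hessOp φ η U' τ)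
            (Q := QtorusW L m hL φ U' hα1' hU1' hreg' (c₀ := c₀) (c₁ := c₁)) φ hpos' hQ' lev₁ (nabla115 η U') f‖ ≤ KG * δ * ‖f‖) ∧
      (∀ B : NegSize (L : ℝ) η levB 0 𝔸,
        ‖LinearMap.toContinuousLinearMap
            ((jetLinearEquiv (L : ℝ) η lev₀ lev₁ (nabla115 η U')).symm.toLinearMap ∘ₗ
              (jetLinearEquiv (L : ℝ) η lev₀ lev₁ (nabla115 η U)).toLinearMap)
            (H1LatticeCLM (L := (L : ℝ)) (η := η) (lev₀ := lev₀) (levB := levB) φ hpos hQ lev₁ (nabla115 η U) B) -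
          H1LatticeCLM (L := (L : ℝ)) (η := η) (lev₀ := lev₀) (levB := levB) (Δ₁ := hessOp φ η U' τ)
            (Q := QtorusW L m hL φ U' hα1' hU1' hreg' (c₀ := c₀) (c₁ := c₁)) φ hpos' hQ' lev₁ (nabla115 η U') B‖ ≤ KA * δ * ‖B‖) := by
  have hη : η ≠ 0 := ne_of_gt (Fact.out : 0 < η)
  obtain ⟨C₁, C₂, ε₇, hC₁, hC₂, hε₇, HGH⟩ := exists_lipschitz_G1_H1_twoBackgrounds L m hL φ (c₀ := c₀) (c₁ := c₁) hη ha hMφ hMφ' hφ hφ' τ hτ hCτ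
  obtain ⟨C₃, ε₈, hC₃, hε₈, HfG⟩ := exists_lipschitz_frakG_twoBackgrounds L m hL φ (c₀ := c₀) (c₁ := c₁) hη ha hMφ hMφ' hφ hφ' τ hτ hCτ
  obtain ⟨MD, hMDdef⟩ : ∃ MD : ℝ, MD = 2 * ‖((η : ℂ))⁻¹‖ := ⟨_, rfl⟩
  obtain ⟨K, hKdef⟩ : ∃ K : ℝ, K = max (NegSup.wSup (levWeight (L : ℝ) η lev₀ 1) : ℝ) (NegSup.wSup (levWeight (L : ℝ) η lev₁ 2) * MD) := ⟨_, rfl⟩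
  have hK : 0 ≤ K := by rw [hKdef]; exact le_max_of_le_left (NegSup.wSup (levWeight (L : ℝ) η lev₀ 1)).coe_nonneg
  refine ⟨K * (Mφ * C₃ * (Real.sqrt (c₀ * Fintype.card (Bond d (fineP L m))) * Mφ') / Real.sqrt c₀) * NegSup.wInvSup (levWeight (L : ℝ) η lev₀ 3) + 1,
    K * (Mφ * C₂ * (Real.sqrt (c₁ * Fintype.card (Bond d m)) * Mφ') / Real.sqrt c₀) * NegSup.wInvSup (levWeight (L : ℝ) η levB 0) + 1,
    min ε₇ ε₈, by positivity, by positivity, lt_min hε₇ hε₈, ?_⟩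
  intro U U' α α' hα1 hU1 hreg hα1' hU1' hreg' ε δ hε hε₉ hδ hUε hU'ε hUU' hRS hRS' hpos hQ hpos' hQ'
  have hU'b : ∀ b : Bond d (fineP L m), U' b ∈ U1 𝔸 := fun b => by
    obtain ⟨y, κ'⟩ := b
    have h := hU1' (liftSite y) κ'
    rwa [B9Eq315QTorus.perCfg_apply, perSite_liftSite] at h
  have hU'b2 : ∀ b : Bond d (fineP L m), ‖(U' b : 𝔸)‖ ≤ 1 ∧ ‖(((U' b)⁻¹ : 𝔸ˣ) : 𝔸)‖ ≤ 1 := fun b => B7Prop1Explicit.mem_U1.1 (hU'b b)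
  obtain ⟨-, hH⟩ := HGH U U' hα1 hU1 hreg hα1' hU1' hreg' hε (hε₉.trans (min_le_left _ _)) hδ hUε hU'ε hUU' hRS hRS' hpos hQ hpos' hQ'
  have hG := HfG U U' hα1 hU1 hreg hα1' hU1' hreg' hε (hε₉.trans (min_le_right _ _)) hδ hUε hU'ε hUU' hRS hRS' hpos hQ hpos' hQ'
  have hD' : ∀ g : Bond d (fineP L m) → 𝔸, ‖nabla115 η U' g‖ ≤ MD * ‖g‖ := fun g => by
    rw [hMDdef]
    exact norm_nabla115_le η _ hU'b2 g
  refine ⟨fun f => ?_, fun B => ?_⟩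
  · have e1 : LinearMap.toContinuousLinearMap
            ((jetLinearEquiv (L : ℝ) η lev₀ lev₁ (nabla115 η U')).symm.toLinearMap ∘ₗ
              (jetLinearEquiv (L : ℝ) η lev₀ lev₁ (nabla115 η U)).toLinearMap)
            (frakGLatticeCLM (L := (L : ℝ)) (η := η) (lev₀ := lev₀) φ hpos hQ lev₁ (nabla115 η U) f) =
        toCLM115 (L := (L : ℝ)) (η := η) (lev₀ := lev₀) lev₁ (nabla115 η U')
          (readFun φ (fun _ => c₀) (fun _ => c₀) (frakGLatticeK hpos hQ)) f :=
      jetId_frakG_eq_toCLM115_readFun (L := (L : ℝ)) (η := η) (lev₀ := lev₀) φ lev₁ (nabla115 η U) (nabla115 η U')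
        (G1LatticeK hpos) (QtorusW L m hL φ U hα1 hU1 hreg (c₀ := c₀) (c₁ := c₁)) (KinvLatticeK hpos hQ)
        (covDerivL2K ℂ c₀ ((η : ℂ))⁻¹ (adTransportW φ U)) (B9Eq326OperatorAssembly.RofU L m φ η U)
        (covDivL2K ℂ c₀ ((η : ℂ))⁻¹ (adTransportW φ fun b => (U b)⁻¹)) f
    have e2 : frakGLatticeCLM (L := (L : ℝ)) (η := η) (lev₀ := lev₀) (Δ₁ := hessOp φ η U' τ)
            (Q := QtorusW L m hL φ U' hα1' hU1' hreg' (c₀ := c₀) (c₁ := c₁)) φ hpos' hQ' lev₁ (nabla115 η U') f =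
        toCLM115 (L := (L : ℝ)) (η := η) (lev₀ := lev₀) lev₁ (nabla115 η U')
          (readFun φ (fun _ => c₀) (fun _ => c₀) (frakGLatticeK (Δ₁ := hessOp φ η U' τ)
            (Q := QtorusW L m hL φ U' hα1' hU1' hreg' (c₀ := c₀) (c₁ := c₁)) hpos' hQ')) f :=
      frakG_eq_toCLM115_readFun (L := (L : ℝ)) (η := η) (lev₀ := lev₀) φ lev₁ (nabla115 η U')
        (G1LatticeK hpos') (QtorusW L m hL φ U' hα1' hU1' hreg' (c₀ := c₀) (c₁ := c₁)) (KinvLatticeK hpos' hQ')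
        (covDerivL2K ℂ c₀ ((η : ℂ))⁻¹ (adTransportW φ U')) (B9Eq326OperatorAssembly.RofU L m φ η U')
        (covDivL2K ℂ c₀ ((η : ℂ))⁻¹ (adTransportW φ fun b => (U' b)⁻¹)) f
    rw [e1, e2]
    have h := norm_toCLM115_readFun_sub_le (L := (L : ℝ)) (η := η) (lev₀ := lev₀) φ hMφ hφ hMφ' hφ' lev₁ (nabla115 η U')
      (frakGLatticeK hpos hQ) (frakGLatticeK (Δ₁ := hessOp φ η U' τ)
        (Q := QtorusW L m hL φ U' hα1' hU1' hreg' (c₀ := c₀) (c₁ := c₁)) hpos' hQ') (by positivity : 0 ≤ C₃ * δ) hG hD' f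
    rw [← hKdef] at h
    refine h.trans ?_
    have hf := norm_nonneg f
    have h1 : K * (Mφ * (C₃ * δ) * (Real.sqrt (c₀ * Fintype.card (Bond d (fineP L m))) * Mφ') / Real.sqrt c₀) *
        NegSup.wInvSup (levWeight (L : ℝ) η lev₀ 3) * ‖f‖ =
      (K * (Mφ * C₃ * (Real.sqrt (c₀ * Fintype.card (Bond d (fineP L m))) * Mφ') / Real.sqrt c₀) * NegSup.wInvSup (levWeight (L : ℝ) η lev₀ 3)) *
        δ * ‖f‖ := by ring
    rw [h1]
    nlinarith [mul_nonneg hδ hf]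
  · have e1 : LinearMap.toContinuousLinearMap
            ((jetLinearEquiv (L : ℝ) η lev₀ lev₁ (nabla115 η U')).symm.toLinearMap ∘ₗ
              (jetLinearEquiv (L : ℝ) η lev₀ lev₁ (nabla115 η U)).toLinearMap)
            (H1LatticeCLM (L := (L : ℝ)) (η := η) (lev₀ := lev₀) (levB := levB) φ hpos hQ lev₁ (nabla115 η U) B) =
        H1CLM (L := (L : ℝ)) (η := η) (lev₀ := lev₀) (levB := levB) φ lev₁ (nabla115 η U') (H1LatticeK hpos hQ) B := rfl
    have e2 : H1LatticeCLM (L := (L : ℝ)) (η := η) (lev₀ := lev₀) (levB := levB) (Δ₁ := hessOp φ η U' τ)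
            (Q := QtorusW L m hL φ U' hα1' hU1' hreg' (c₀ := c₀) (c₁ := c₁)) φ hpos' hQ' lev₁ (nabla115 η U') B =
        H1CLM (L := (L : ℝ)) (η := η) (lev₀ := lev₀) (levB := levB) φ lev₁ (nabla115 η U') (H1LatticeK (Δ₁ := hessOp φ η U' τ)
          (Q := QtorusW L m hL φ U' hα1' hU1' hreg' (c₀ := c₀) (c₁ := c₁)) hpos' hQ') B := rfl
    rw [e1, e2]
    have h := norm_H1CLM_sub_le (L := (L : ℝ)) (η := η) (lev₀ := lev₀) (levB := levB) φ hMφ hφ hMφ' hφ' lev₁ (nabla115 η U')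
      (H1LatticeK hpos hQ) (H1LatticeK (Δ₁ := hessOp φ η U' τ)
        (Q := QtorusW L m hL φ U' hα1' hU1' hreg' (c₀ := c₀) (c₁ := c₁)) hpos' hQ') (by positivity : 0 ≤ C₂ * δ) hH hD' B
    rw [← hKdef] at h
    refine h.trans ?_
    have hB := norm_nonneg B
    have h1 : K * (Mφ * (C₂ * δ) * (Real.sqrt (c₁ * Fintype.card (Bond d m)) * Mφ') / Real.sqrt c₀) *
        NegSup.wInvSup (levWeight (L : ℝ) η levB 0) * ‖B‖ =
      (K * (Mφ * C₂ * (Real.sqrt (c₁ * Fintype.card (Bond d m)) * Mφ') / Real.sqrt c₀) * NegSup.wInvSup (levWeight (L : ℝ) η levB 0)) *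
        δ * ‖B‖ := by ring
    rw [h1]
    nlinarith [mul_nonneg hδ hB]

end Letters

end Literature.MathematicalPhysics.QuantumFieldTheory.Balaban1983to89.B11Eq117LetterDefectsTwoBackgrounds

end
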